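import Literature.NumberTheory.Automorphic.ArchEndoscopicChartOrbUnfoldLeaves      -- ★ p850744 (this seat): (α1) per-place leaves `exists_placeLeaves_archRH_mul_chartOrbH_eq_of_isHaarMeasure` (compact leaves explicit, per-place properness)
import HarnessLib

/-!
# UNIFORM UNFOLDING WITH A SET OF COMPACT PLACES INTEGRATED OUT FIRST: `R_S(c) · chartOrbH c = K₀ · E_S(c) · ∫_{z'} ( ∫_{Π_{w∈P} U(Φ₂)_w} fH(…) d(⊗_{w∈P} ν_w) ) d(⊗_{w∉P} Λ_w)`
# — the Fubini-ready form on which the one-place Casimir engines act (stage (α4¹) of the transport of ★ (ELL-∞) to Bouaziz (I₂); Varadarajan 1989 §6.4, Shelstad 1979 §4)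

Topic `NumberTheory/Automorphic`; namespace `Literature.NumberTheory.Automorphic.UnitaryGroup`.  THEOREMS ONLY (no `def`, no instance, no axiom, no `sorry`).  Cell `pub/hodgecm-mathlib`,
crux H413 (`stmt-HodgeConjecture-24833`), line LH3 (closer stub `stub_N9`, DIRECT ROAD), organ O-L3′ conjunct (ii) pay-down for GENERAL `fH` (LH3-plan (g3) RULINGS #7 (d) ∕ #11), stage
(α4¹): the FUBINI STEP of the all-orders transport.  Author LH3-p01 (g4).  Count-neutral.

THE MATHEMATICS.  ★ (α1) `exists_placeLeaves_archRH_mul_chartOrbH_eq_of_isHaarMeasure` reads, for `c ∈ RegS S`,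
  `R_S(c) · chartOrbH νH S fH c = K₀ · E_S(c) · ∫ fH(eA⁻¹ (z_{w,1} γ_w(c_w) z_{w,2} z_{w,1}⁻¹)_w, b(c)) d(⊗_w Λ_w)(z)`
with the compact-place leaves EXPLICIT, `Λ_w = (g ↦ (g,1))_* ν_w` (`w ∉ S`).  For a set `P ⊆ Sᶜ` of compact places (the wall places of a base point), split
`⊗_w Λ_w = (⊗_{w∈P} Λ_w) ⊗ (⊗_{w∉P} Λ_w)` (Mathlib `measurePreserving_piEquivPiSubtypeProd`), apply Fubini (the integrand is bounded and carried by a box of finite measure — properness at the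
single point `c`, **`integrable_unfoldIntegrand`**), and read the `P`-leaves as the whole groups (`Measure.pi_map_pi`):
  **`exists_placeLeaves_archRH_mul_chartOrbH_eq_integral_integral`**:  `R_S(c) · chartOrbH νH S fH c = K₀ · E_S(c) · ∫_{z' ∈ Π_{w∉P}(G_w × G_w)} ( ∫_{g ∈ Π_{w∈P} G_w} fH(eA⁻¹ (w ↦
  [w ∈ P ? g_w γ_w(c_w) g_w⁻¹ : z'_{w,1} γ_w(c_w) z'_{w,2} z'_{w,1}⁻¹]), b(c)) d(⊗_{w∈P} ν_w)(g) ) d(⊗_{w∉P} Λ_w)(z')`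
— the inner integral is the `|P|`-fold elliptic orbital integral of the places `P` (the functional of ★ (ELL-∞) ∕ ★ (α2), one place at a time), the outer variables are parameters.  §3 records the
chart point of a compact place in CAYLEY-CENTRE FORM for EVERY integer `m` (**`endoBlock_eq_cayleyTorus_of_not_mem`**: `γ_w(c) = P · diag(u e^{iψ}, u e^{−iψ}) · P⁻¹`, `ψ = (c_w0 − c_w2)/2 − mπ`,
`u = e^{i((c_w0 + c_w2)/2 + mπ)}`), the substitution under which the inner integral at a single place `P = {w₀}` IS `(2 sin ψ)⁻¹ · F_{f̃}(ψ)` for the engine's `F`.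
HONEST LABEL: HC_CM is proved only modulo the 7 printed citations (2 remaining: hLiu418 = stmt-HodgeConjecture-24832, h413 = stmt-HodgeConjecture-24833) until rung 0 closes;
measure-theoretic bookkeeping over ★ (α1), pays nothing by itself.

## References
* [Varadarajan1989] V. S. Varadarajan, *An Introduction to Harmonic Analysis on Semisimple Lie Groups*, Cambridge Stud. Adv. Math. 16 (1989), §6.4 Lemma 21, Thm 23.
* [Shelstad1979] D. Shelstad, *Characters and inner forms of a quasi-split group over ℝ*, Compositio Math. 39 (1979), §4 pp. 22–25.
* [Folland1995] G. B. Folland, *A Course in Abstract Harmonic Analysis* (1995), §2.6 (2.52).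
* [Rogawski1990] J. D. Rogawski, *Automorphic Representations of Unitary Groups in Three Variables*, Ann. of Math. Stud. 123 (1990), §8.2 pp. 119–122.
-/

set_option autoImplicit false

noncomputable section

open MeasureTheory Measure Filter Topology Set Function NumberField NumberField.InfinitePlace Matrix Complex
open Literature.MeasureTheory.Group Literature.NumberTheory.Automorphic.ArchCartan
open scoped MatrixGroups Matrix ENNReal NNReal ComplexConjugate Classical

namespace Literature.NumberTheory.Automorphic.UnitaryGroup

local notation3 "Φ₂[" L "]" => (Matrix.of fun i j : Fin 2 => if i.val + j.val + 1 = 2 then (1 : L) else 0)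
local notation3 "Φ₁[" L "]" => (Matrix.of fun i j : Fin 1 => if i.val + j.val + 1 = 1 then (1 : L) else 0)
local notation3 "𝔸[" L "]" => ↥(arch (↥(maximalRealSubfield L)) L (IsCMField.complexConj L) 2 Φ₂[L])
local notation3 "𝔹[" L "]" => ↥(arch (↥(maximalRealSubfield L)) L (IsCMField.complexConj L) 1 Φ₁[L])

/-! ## §1 The unfolded integrand is integrable against the product of the leaves (bounded, carried by a box of finite measure) -/

section Integrable

variable (L : Type) [Field L] [NumberField L] [IsCMField L] (S : Finset {w : InfinitePlace L // IsComplex w})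
  [∀ w : {w : InfinitePlace L // IsComplex w}, MeasurableSpace ↥(archLocal L 2 Φ₂[L] w)]
  [∀ w : {w : InfinitePlace L // IsComplex w}, BorelSpace ↥(archLocal L 2 Φ₂[L] w)]

/-- **THE UNFOLDED INTEGRAND IS INTEGRABLE**: for continuous compactly supported `fH`, leaves `Λ_w` finite on compacta carried by closed `Z_w` which are proper AT THE POINT `c` (every compact
of `G_w` is reached from a compact of `Z_w`), the integrand `z ↦ fH(eA⁻¹ (z_{w,1} γ_w(c_w) z_{w,2} z_{w,1}⁻¹)_w, b)` is integrable against `⊗_w Λ_w`: it is bounded by `‖fH‖_∞` and vanishes off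
the box `Π_w A_w`, `A_w = {z_w : z_{w,1} γ_w(c_w) z_{w,2} z_{w,1}⁻¹ ∈ C_w}` (`C_w` the `w`-shadow of `supp fH`), of finite measure. [cite: Folland1995, §2.6 (2.52)] [cite: Varadarajan1989, §6.4 Lemma 21] -/
theorem integrable_unfoldIntegrand (fH : 𝔸[L] × 𝔹[L] → ℂ) (hf : Continuous fH) (hfc : HasCompactSupport fH)
    (Λw : ∀ w : {w : InfinitePlace L // IsComplex w}, Measure (↥(archLocal L 2 Φ₂[L] w) × ↥(archLocal L 2 Φ₂[L] w))) [∀ w, IsFiniteMeasureOnCompacts (Λw w)]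
    [∀ w, SigmaFinite (Λw w)]
    (Zw : ∀ w : {w : InfinitePlace L // IsComplex w}, Set (↥(archLocal L 2 Φ₂[L] w) × ↥(archLocal L 2 Φ₂[L] w))) (hZcl : ∀ w, IsClosed (Zw w)) (hZnull : ∀ w, Λw w (Zw w)ᶜ = 0)
    (c : {w : InfinitePlace L // IsComplex w} → Fin 3 → ℝ)
    (hprop : ∀ (w) (C' : Set ↥(archLocal L 2 Φ₂[L] w)), IsCompact C' → ∃ 𝒮 : Set (↥(archLocal L 2 Φ₂[L] w) × ↥(archLocal L 2 Φ₂[L] w)), IsCompact 𝒮 ∧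
      ∀ z ∈ Zw w, z.1 * (endoBlockAt L S w (c w) * z.2) * z.1⁻¹ ∈ C' → z ∈ 𝒮)
    (b : 𝔹[L]) :
    Integrable (fun z : ∀ w : {w : InfinitePlace L // IsComplex w}, ↥(archLocal L 2 Φ₂[L] w) × ↥(archLocal L 2 Φ₂[L] w) =>
      fH ((archPiEquivCM 2 L Φ₂[L]).symm (fun w => (z w).1 * (endoBlockAt L S w (c w) * (z w).2) * (z w).1⁻¹), b)) (Measure.pi Λw) := by
  haveI : ∀ w : {w : InfinitePlace L // IsComplex w}, LocallyCompactSpace ↥(archLocal L 2 Φ₂[L] w) := fun w => locallyCompactSpace_archLocal_two L w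
  haveI : ∀ w : {w : InfinitePlace L // IsComplex w}, SecondCountableTopology ↥(archLocal L 2 Φ₂[L] w) := fun w => secondCountableTopology_archLocal_two L w
  -- the bound and the shadows of the support
  obtain ⟨M, hM⟩ := hfc.exists_bound_of_continuous hf
  have hK : IsCompact (tsupport fH) := hfc
  obtain ⟨Cw, hCw_def⟩ : ∃ Cw : ∀ w : {w : InfinitePlace L // IsComplex w}, Set ↥(archLocal L 2 Φ₂[L] w),
      Cw = fun w => (fun a : 𝔸[L] => archPiEquivCM 2 L Φ₂[L] a w) '' (Prod.fst '' tsupport fH) := ⟨_, rfl⟩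
  have hCw : ∀ w, IsCompact (Cw w) := fun w => by
    rw [hCw_def]
    exact (hK.image continuous_fst).image ((continuous_apply w).comp (archPiEquivCM 2 L Φ₂[L]).continuous)
  have hvan : ∀ (G : ∀ w : {w : InfinitePlace L // IsComplex w}, ↥(archLocal L 2 Φ₂[L] w)), (∃ w, G w ∉ Cw w) → fH ((archPiEquivCM 2 L Φ₂[L]).symm G, b) = 0 := by
    rintro G ⟨w, hw⟩
    by_contra h
    rw [hCw_def] at hw
    refine hw ⟨(archPiEquivCM 2 L Φ₂[L]).symm G, ⟨((archPiEquivCM 2 L Φ₂[L]).symm G, b), subset_tsupport _ h, rfl⟩, ?_⟩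
    show archPiEquivCM 2 L Φ₂[L] ((archPiEquivCM 2 L Φ₂[L]).symm G) w = G w
    rw [ContinuousMulEquiv.apply_symm_apply]
  -- the conjugating maps, the box
  have hm_c : ∀ w : {w : InfinitePlace L // IsComplex w},
      Continuous fun z : ↥(archLocal L 2 Φ₂[L] w) × ↥(archLocal L 2 Φ₂[L] w) => z.1 * (endoBlockAt L S w (c w) * z.2) * z.1⁻¹ :=
    fun w => (continuous_fst.mul (continuous_const.mul continuous_snd)).mul continuous_fst.inv
  have hA_meas : ∀ w : {w : InfinitePlace L // IsComplex w},
      MeasurableSet {z : ↥(archLocal L 2 Φ₂[L] w) × ↥(archLocal L 2 Φ₂[L] w) | z.1 * (endoBlockAt L S w (c w) * z.2) * z.1⁻¹ ∈ Cw w} :=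
    fun w => ((hCw w).isClosed.preimage (hm_c w)).measurableSet
  have hA_fin : ∀ w : {w : InfinitePlace L // IsComplex w}, Λw w {z | z.1 * (endoBlockAt L S w (c w) * z.2) * z.1⁻¹ ∈ Cw w} < ⊤ := by
    intro w
    obtain ⟨𝒮, h𝒮c, h𝒮⟩ := hprop w (Cw w) (hCw w)
    have hle : Λw w {z | z.1 * (endoBlockAt L S w (c w) * z.2) * z.1⁻¹ ∈ Cw w} ≤ Λw w 𝒮 := by
      rw [← measure_inter_add_sdiff {z | z.1 * (endoBlockAt L S w (c w) * z.2) * z.1⁻¹ ∈ Cw w} (hZcl w).measurableSet]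
      have h2 : Λw w ({z | z.1 * (endoBlockAt L S w (c w) * z.2) * z.1⁻¹ ∈ Cw w} \ Zw w) = 0 := measure_mono_null (fun z hz => hz.2) (hZnull w)
      rw [h2, add_zero]
      exact measure_mono fun z hz => h𝒮 z hz.2 hz.1
    exact hle.trans_lt h𝒮c.measure_lt_top
  have hbox_meas : MeasurableSet (Set.pi univ fun w : {w : InfinitePlace L // IsComplex w} =>
      {z : ↥(archLocal L 2 Φ₂[L] w) × ↥(archLocal L 2 Φ₂[L] w) | z.1 * (endoBlockAt L S w (c w) * z.2) * z.1⁻¹ ∈ Cw w}) := MeasurableSet.univ_pi hA_meas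
  have hbox_fin : (Measure.pi Λw) (Set.pi univ fun w : {w : InfinitePlace L // IsComplex w} =>
      {z : ↥(archLocal L 2 Φ₂[L] w) × ↥(archLocal L 2 Φ₂[L] w) | z.1 * (endoBlockAt L S w (c w) * z.2) * z.1⁻¹ ∈ Cw w}) < ⊤ := by
    rw [Measure.pi_pi]
    exact ENNReal.prod_lt_top fun w _ => hA_fin w
  -- continuity of the integrand, domination by the indicator of the box
  have hΨc : Continuous fun z : ∀ w : {w : InfinitePlace L // IsComplex w}, ↥(archLocal L 2 Φ₂[L] w) × ↥(archLocal L 2 Φ₂[L] w) =>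
      fH ((archPiEquivCM 2 L Φ₂[L]).symm (fun w => (z w).1 * (endoBlockAt L S w (c w) * (z w).2) * (z w).1⁻¹), b) :=
    hf.comp (((archPiEquivCM 2 L Φ₂[L]).symm.continuous.comp (continuous_pi fun w => (hm_c w).comp (continuous_apply w))).prodMk continuous_const)
  refine Integrable.mono' ((integrable_indicator_iff hbox_meas).2 (integrableOn_const (C := M) hbox_fin.ne)) hΨc.aestronglyMeasurable (Eventually.of_forall fun z => ?_)
  by_cases hz : z ∈ Set.pi univ fun w : {w : InfinitePlace L // IsComplex w} =>
      {z : ↥(archLocal L 2 Φ₂[L] w) × ↥(archLocal L 2 Φ₂[L] w) | z.1 * (endoBlockAt L S w (c w) * z.2) * z.1⁻¹ ∈ Cw w}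
  · rw [indicator_of_mem hz]
    exact hM _
  · rw [indicator_of_notMem hz]
    have hz' : ∃ w, (z w).1 * (endoBlockAt L S w (c w) * (z w).2) * (z w).1⁻¹ ∉ Cw w := by
      by_contra h
      push Not at h
      exact hz fun w _ => h w
    rw [hvan _ hz', norm_zero]

end Integrable

/-! ## §2 The unfolding with the places `P ⊆ Sᶜ` integrated out first -/

section WallPlaces

variable (L : Type) [Field L] [NumberField L] [IsCMField L] (S : Finset {w : InfinitePlace L // IsComplex w})
  [∀ w : {w : InfinitePlace L // IsComplex w}, MeasurableSpace ↥(archLocal L 2 Φ₂[L] w)]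
  [∀ w : {w : InfinitePlace L // IsComplex w}, BorelSpace ↥(archLocal L 2 Φ₂[L] w)]
  [MeasurableSpace 𝔸[L]] [BorelSpace 𝔸[L]] [MeasurableSpace 𝔹[L]] [BorelSpace 𝔹[L]]
  (νH : Measure (𝔸[L] × 𝔹[L])) [νH.IsHaarMeasure] [νH.IsMulRightInvariant]

set_option maxHeartbeats 400000 in
/-- **UNIFORM UNFOLDING, THE COMPACT PLACES `P ⊆ Sᶜ` INTEGRATED OUT FIRST.**  As ★ `exists_placeLeaves_archRH_mul_chartOrbH_eq_of_isHaarMeasure` (same clauses: Haar `ν_w` exported, `K₀`,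
leaves `Λ_w` finite on compacta, closed `Z_w` carrying them, compact leaves explicit, per-place properness), with the identity in FUBINI FORM: for `c ∈ RegS S`,
`R_S(c) · chartOrbH νH S fH c = K₀ · E_S(c) · ∫_{z' ∈ Π_{w∉P}(G_w×G_w)} ( ∫_{g ∈ Π_{w∈P} G_w} fH(eA⁻¹ (w ↦ [w ∈ P ? g_w γ_w(c_w) g_w⁻¹ : z'_{w,1} γ_w(c_w) z'_{w,2} z'_{w,1}⁻¹]), b(c)) d(⊗_{w∈P} ν_w) ) d(⊗_{w∉P} Λ_w)`
— the inner integral is the iterated elliptic orbital integral of the places `P`. [cite: Varadarajan1989, §6.4 Lemma 21, Thm 23] [cite: Shelstad1979, §4 pp. 22–25] [cite: Folland1995, §2.6 (2.52)] -/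
theorem exists_placeLeaves_archRH_mul_chartOrbH_eq_integral_integral (fH : 𝔸[L] × 𝔹[L] → ℂ) (hf : Continuous fH) (hfc : HasCompactSupport fH)
    (p : {w : InfinitePlace L // IsComplex w} → Prop) [DecidablePred p] (hp : ∀ w, p w → w ∉ S) :
    ∃ (νw : ∀ w : {w : InfinitePlace L // IsComplex w}, Measure ↥(archLocal L 2 Φ₂[L] w)) (_ : ∀ w, (νw w).IsHaarMeasure) (_ : ∀ w, (νw w).IsMulRightInvariant)
      (K₀ : ℝ) (Λw : ∀ w : {w : InfinitePlace L // IsComplex w}, Measure (↥(archLocal L 2 Φ₂[L] w) × ↥(archLocal L 2 Φ₂[L] w)))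
      (Zw : ∀ w : {w : InfinitePlace L // IsComplex w}, Set (↥(archLocal L 2 Φ₂[L] w) × ↥(archLocal L 2 Φ₂[L] w))),
      (∀ w, IsFiniteMeasureOnCompacts (Λw w)) ∧ (∀ w, IsClosed (Zw w)) ∧ (∀ w, Λw w (Zw w)ᶜ = 0) ∧
      (∀ w, w ∉ S → Λw w = Measure.map (fun g : ↥(archLocal L 2 Φ₂[L] w) => (g, (1 : ↥(archLocal L 2 Φ₂[L] w)))) (νw w)) ∧
      (∀ (w) (U : Set ({w : InfinitePlace L // IsComplex w} → Fin 3 → ℝ)), IsCompact U → (w ∉ S → ∀ c ∈ U, Circle.exp (c w 0) ≠ Circle.exp (c w 2)) →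
        ∀ C' : Set ↥(archLocal L 2 Φ₂[L] w), IsCompact C' →
          ∃ 𝒮 : Set (↥(archLocal L 2 Φ₂[L] w) × ↥(archLocal L 2 Φ₂[L] w)), IsCompact 𝒮 ∧
            ∀ z ∈ Zw w, ∀ c ∈ U, z.1 * (endoBlockAt L S w (c w) * z.2) * z.1⁻¹ ∈ C' → z ∈ 𝒮) ∧
      ∀ c : {w : InfinitePlace L // IsComplex w} → Fin 3 → ℝ, c ∈ RegS S →
        archRH S c * chartOrbH L νH S fH c =
          (K₀ : ℂ) * (∏ w, (if w ∈ S then ((Real.exp (c w 0) : ℝ) : ℂ) else 1 - (Circle.exp (c w 2 - c w 0) : ℂ))) *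
            ∫ z' : ∀ w : {w : {w : InfinitePlace L // IsComplex w} // ¬ p w}, ↥(archLocal L 2 Φ₂[L] w.1) × ↥(archLocal L 2 Φ₂[L] w.1),
              (∫ g : ∀ w : {w : {w : InfinitePlace L // IsComplex w} // p w}, ↥(archLocal L 2 Φ₂[L] w.1),
                fH ((archPiEquivCM 2 L Φ₂[L]).symm (fun w => if h : p w then g ⟨w, h⟩ * endoBlockAt L S w (c w) * (g ⟨w, h⟩)⁻¹
                  else (z' ⟨w, h⟩).1 * (endoBlockAt L S w (c w) * (z' ⟨w, h⟩).2) * (z' ⟨w, h⟩).1⁻¹), (endoTorus L S c).2)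
                ∂(Measure.pi fun w : {w : {w : InfinitePlace L // IsComplex w} // p w} => νw w.1))
              ∂(Measure.pi fun w : {w : {w : InfinitePlace L // IsComplex w} // ¬ p w} => Λw w.1) := by
  haveI : ∀ w : {w : InfinitePlace L // IsComplex w}, LocallyCompactSpace ↥(archLocal L 2 Φ₂[L] w) := fun w => locallyCompactSpace_archLocal_two L w
  haveI : ∀ w : {w : InfinitePlace L // IsComplex w}, SecondCountableTopology ↥(archLocal L 2 Φ₂[L] w) := fun w => secondCountableTopology_archLocal_two L w
  obtain ⟨νw, hνH', hνR, K₀, Λw, Zw, hΛfin, hZcl, hZnull, hexpl, hprop, hid⟩ := exists_placeLeaves_archRH_mul_chartOrbH_eq_of_isHaarMeasure L S νH fH hf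
  haveI : ∀ w, (νw w).IsHaarMeasure := hνH'
  haveI : ∀ w, IsFiniteMeasureOnCompacts (Λw w) := hΛfin
  haveI : ∀ w, SigmaFinite (Λw w) := fun w => inferInstance
  refine ⟨νw, hνH', hνR, K₀, Λw, Zw, hΛfin, hZcl, hZnull, hexpl, hprop, fun c hc => ?_⟩
  rw [hid c hc]
  congr 1
  -- abbreviations: the integrand `Ψ` (generalised), the splitting equivalence `e`, the leaf embedding `ι`
  obtain ⟨Ψ, hΨ_def⟩ : ∃ Ψ : (∀ w : {w : InfinitePlace L // IsComplex w}, ↥(archLocal L 2 Φ₂[L] w) × ↥(archLocal L 2 Φ₂[L] w)) → ℂ,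
      Ψ = fun z => fH ((archPiEquivCM 2 L Φ₂[L]).symm (fun w => (z w).1 * (endoBlockAt L S w (c w) * (z w).2) * (z w).1⁻¹), (endoTorus L S c).2) := ⟨_, rfl⟩
  have hLHS : (∫ z, fH ((archPiEquivCM 2 L Φ₂[L]).symm (fun w => (z w).1 * (endoBlockAt L S w (c w) * (z w).2) * (z w).1⁻¹), (endoTorus L S c).2) ∂(Measure.pi Λw)) =
      ∫ z, Ψ z ∂(Measure.pi Λw) := by rw [hΨ_def]
  rw [hLHS]
  let e := MeasurableEquiv.piEquivPiSubtypeProd (fun w : {w : InfinitePlace L // IsComplex w} => ↥(archLocal L 2 Φ₂[L] w) × ↥(archLocal L 2 Φ₂[L] w)) p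
  -- (1) integrability (properness at the single point `c`)
  have hreg : ∀ w, w ∉ S → Circle.exp (c w 0) ≠ Circle.exp (c w 2) := ((mem_regS_iff S c).1 hc).1
  have hint : Integrable Ψ (Measure.pi Λw) := by
    rw [hΨ_def]
    refine integrable_unfoldIntegrand L S fH hf hfc Λw Zw hZcl hZnull c (fun w C' hC' => ?_) (endoTorus L S c).2
    obtain ⟨𝒮, h𝒮, h⟩ := hprop w {c} isCompact_singleton (fun hw c' hc' => by rw [Set.mem_singleton_iff.1 hc']; exact hreg w hw) C' hC'
    exact ⟨𝒮, h𝒮, fun z hz hzC => h z hz c (Set.mem_singleton c) hzC⟩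
  -- (2) split the product of the leaves and apply Fubini
  have hmp : MeasurePreserving e (Measure.pi Λw) ((Measure.pi fun w : {w // p w} => Λw w.1).prod (Measure.pi fun w : {w // ¬ p w} => Λw w.1)) :=
    measurePreserving_piEquivPiSubtypeProd Λw p
  have hmp' : MeasurePreserving e.symm ((Measure.pi fun w : {w // p w} => Λw w.1).prod (Measure.pi fun w : {w // ¬ p w} => Λw w.1)) (Measure.pi Λw) := hmp.symm e
  have hint' : Integrable (Ψ ∘ e.symm) ((Measure.pi fun w : {w // p w} => Λw w.1).prod (Measure.pi fun w : {w // ¬ p w} => Λw w.1)) :=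
    (hmp'.integrable_comp_emb e.symm.measurableEmbedding).2 hint
  rw [← hmp'.integral_comp' Ψ, integral_prod_symm (fun z => Ψ (e.symm z)) hint']
  refine integral_congr_ae (Eventually.of_forall fun z' => ?_)
  -- (3) the inner integral: the `P`-leaves are the whole groups
  have hι : ∀ w : {w // p w}, Measurable fun g : ↥(archLocal L 2 Φ₂[L] w.1) => (g, (1 : ↥(archLocal L 2 Φ₂[L] w.1))) := fun w => measurable_id.prodMk measurable_const
  haveI : ∀ w : {w // p w}, SigmaFinite ((νw w.1).map fun g : ↥(archLocal L 2 Φ₂[L] w.1) => (g, (1 : ↥(archLocal L 2 Φ₂[L] w.1)))) := fun w => by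
    rw [← hexpl w.1 (hp w.1 w.2)]; infer_instance
  have hpi : (Measure.pi fun w : {w // p w} => Λw w.1) =
      (Measure.pi fun w : {w // p w} => νw w.1).map (fun g w => (g w, (1 : ↥(archLocal L 2 Φ₂[L] w.1)))) := by
    rw [Measure.pi_map_pi fun w => (hι w).aemeasurable]
    exact congrArg Measure.pi (funext fun w => hexpl w.1 (hp w.1 w.2))
  -- measurability of the integrand (continuity; the product of second-countable Borel groups is Borel)
  have hΨc : Continuous Ψ := by
    rw [hΨ_def]
    exact hf.comp (((archPiEquivCM 2 L Φ₂[L]).symm.continuous.comp (continuous_pi fun w =>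
      ((continuous_fst.mul (continuous_const.mul continuous_snd)).mul continuous_fst.inv).comp (continuous_apply w))).prodMk continuous_const)
  have hΨm : Measurable Ψ := hΨc.measurable
  have hGm : Measurable fun (g : ∀ w : {w // p w}, ↥(archLocal L 2 Φ₂[L] w.1)) (w : {w // p w}) => (g w, (1 : ↥(archLocal L 2 Φ₂[L] w.1))) :=
    measurable_pi_lambda _ fun w => (hι w).comp (measurable_pi_apply w)
  show ∫ x, (Ψ ∘ e.symm) (x, z') ∂(Measure.pi fun w : {w // p w} => Λw w.1) = _
  rw [hpi]
  have hsm : AEStronglyMeasurable (fun x : ∀ w : {w // p w}, ↥(archLocal L 2 Φ₂[L] w.1) × ↥(archLocal L 2 Φ₂[L] w.1) => (Ψ ∘ e.symm) (x, z'))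
      ((Measure.pi fun w : {w // p w} => νw w.1).map (fun g w => (g w, (1 : ↥(archLocal L 2 Φ₂[L] w.1))))) :=
    (hΨm.comp (e.symm.measurable.comp measurable_prodMk_right)).aestronglyMeasurable
  rw [integral_map hGm.aemeasurable hsm]
  refine integral_congr_ae (Eventually.of_forall fun g => ?_)
  -- (4) pointwise: the split point, the compact leaves at `(g_w, 1)`
  show Ψ (e.symm (fun w : {w // p w} => (g w, (1 : ↥(archLocal L 2 Φ₂[L] w.1))), z')) = _
  rw [hΨ_def]
  refine congrArg (fun F : ∀ w : {w : InfinitePlace L // IsComplex w}, ↥(archLocal L 2 Φ₂[L] w) =>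
    fH ((archPiEquivCM 2 L Φ₂[L]).symm F, (endoTorus L S c).2)) (funext fun w => ?_)
  have hw : e.symm (fun w : {w // p w} => (g w, (1 : ↥(archLocal L 2 Φ₂[L] w.1))), z') w =
      (if h : p w then (g ⟨w, h⟩, (1 : ↥(archLocal L 2 Φ₂[L] w))) else z' ⟨w, h⟩) := rfl
  rw [hw]
  by_cases h : p w
  · rw [dif_pos h, dif_pos h, mul_one]
  · rw [dif_neg h, dif_neg h]

end WallPlaces

/-! ## §3 The chart point of a compact place in Cayley-centre form, for every integer `m` -/

section CayleyCentre

variable (L : Type) [Field L] (S : Finset {w : InfinitePlace L // IsComplex w}) (w : {w : InfinitePlace L // IsComplex w})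

/-- **THE CHART POINT OF A COMPACT PLACE IN CAYLEY-CENTRE FORM**: for `w ∉ S` and every integer `m`, `γ_w(c) = P · diag(u e^{iψ}, u e^{−iψ}) · P⁻¹` with `ψ = (c_w0 − c_w2)/2 − mπ` and
`u = e^{i((c_w0 + c_w2)/2 + mπ)}` — the torus point of ★ (ELL-∞) ∕ ★ (α2) with centre `u`; near a wall point `e^{ic₀_w0} = e^{ic₀_w2}` (`c₀_w0 − c₀_w2 = 2mπ`) the normal coordinate `ψ`
tends to `0`. [cite: Rogawski1990, §8.2 p. 122] [cite: Varadarajan1989, §6.4 Lemma 21] -/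
theorem endoBlock_eq_cayleyTorus_of_not_mem (hwS : w ∉ S) (c : {w : InfinitePlace L // IsComplex w} → Fin 3 → ℝ) (m : ℤ) :
    endoBlock L S c w = ⟨Matrix.GeneralLinearGroup.mkOfDetNeZero !![(1 : ℂ), 1; 1, -1] det_cayleyTwo_ne_zero *
      circleDiagonal 2 ![Circle.exp ((c w 0 + c w 2) / 2 + m * Real.pi) * Circle.exp ((c w 0 - c w 2) / 2 - m * Real.pi),
        Circle.exp ((c w 0 + c w 2) / 2 + m * Real.pi) * Circle.exp (-((c w 0 - c w 2) / 2 - m * Real.pi))] *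
      (Matrix.GeneralLinearGroup.mkOfDetNeZero !![(1 : ℂ), 1; 1, -1] det_cayleyTwo_ne_zero)⁻¹, cayley_conj_circleDiagonal_mem_archLocal L w _⟩ := by
  have h1 : Circle.exp ((c w 0 + c w 2) / 2 + m * Real.pi) * Circle.exp ((c w 0 - c w 2) / 2 - m * Real.pi) = Circle.exp (c w 0) := by
    rw [← Circle.exp_add]; congr 1; ring
  have h2 : Circle.exp ((c w 0 + c w 2) / 2 + m * Real.pi) * Circle.exp (-((c w 0 - c w 2) / 2 - m * Real.pi)) = Circle.exp (c w 2) := by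
    rw [← Circle.exp_add, show (c w 0 + c w 2) / 2 + m * Real.pi + -((c w 0 - c w 2) / 2 - m * Real.pi) = c w 2 + m * (2 * Real.pi) by ring,
      Circle.exp_add, Circle.exp_int_mul_two_pi, mul_one]
  rw [h1, h2]
  unfold endoBlock
  rw [if_neg hwS]

/-- **The compact normalising factor in the normal coordinate**: `‖1 − e^{i(c_w2 − c_w0)}‖ = 2|sin ψ|`, `ψ = (c_w0 − c_w2)/2 − mπ`, for every integer `m`.
[cite: Varadarajan1989, §6.4 Lemma 21] -/
theorem norm_one_sub_circleExp_eq_two_mul_abs_sin (c : {w : InfinitePlace L // IsComplex w} → Fin 3 → ℝ) (m : ℤ) :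
    ‖(1 : ℂ) - (Circle.exp (c w 2 - c w 0) : ℂ)‖ = 2 * |Real.sin ((c w 0 - c w 2) / 2 - m * Real.pi)| := by
  rw [Circle.coe_exp, norm_sub_rev, mul_comm ((c w 2 - c w 0 : ℝ) : ℂ) I, Complex.norm_exp_I_mul_ofReal_sub_one, Real.norm_eq_abs, abs_mul, abs_two,
    show (c w 2 - c w 0) / 2 = -((c w 0 - c w 2) / 2 - m * Real.pi + m * Real.pi) by ring, Real.sin_neg, abs_neg, Real.sin_add_int_mul_pi, abs_mul,
    abs_neg_one_zpow, one_mul]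

/-- **The normal coordinate detects the wall**: `(c_w0 − c_w2)/2 − mπ = 0 → e^{ic_w0} = e^{ic_w2}`; so at a point regular at `w` it is nonzero. [cite: Varadarajan1989, §6.4 Lemma 21] -/
theorem circleExp_eq_of_sub_div_two_sub_eq_zero (c : {w : InfinitePlace L // IsComplex w} → Fin 3 → ℝ) (m : ℤ) (h : (c w 0 - c w 2) / 2 - m * Real.pi = 0) :
    Circle.exp (c w 0) = Circle.exp (c w 2) := by
  rw [show c w 0 = c w 2 + m * (2 * Real.pi) by linarith, Circle.exp_add, Circle.exp_int_mul_two_pi, mul_one]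

end CayleyCentre

end Literature.NumberTheory.Automorphic.UnitaryGroup

end
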